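import Literature.MathematicalPhysics.QuantumFieldTheory.WilsonOddRPNegCoords
import Literature.MathematicalPhysics.QuantumFieldTheory.LatticeSiteRPKernelMechanism
import HarnessLib

/-!
# Odd-torus reflection positivity of the Wilson measure with a positive kernel on the shared slice

Theorem-only companion of `ConstructiveQFTWave0OddRPProofs` (reflection positivity of the Wilson
measure on the odd torus in the coordinates `θ t = 1 − t`, covariant form
`wilsonExpectation_nonneg_of_oddCovariant`: observables `Φ (translateLow Y U) = Σₖ gₖ(z) conj gₖ(ΘU)`),
of `WilsonOddRPNegCoords` (its transport to the site-reflection coordinates `t ↦ −t`,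
`wilsonExpectation_nonneg_of_negCovariant`) and of `LatticeSiteRPKernelMechanism` (the abstract
mechanism with a HERMITIAN FORM `Σ_{I,J} g_I(z) conj g_J(ΘU) P_{IJ}(U)` whose kernel depends on the
shared block and is positive semidefinite pointwise).  When the reflection slice carries fermions
(site-reflection positivity of Wilson quarks, Montvay–Münster 1994 §4.2.3 (4.107)–(4.110); Lüscher
1977), integrating them out produces exactly such a Hermitian form; this file supplies the
corresponding gauge-field statements:

* `WilsonOddRP.integral_oddCovKernel_nonneg`, `wilsonExpectation_nonneg_of_oddCovariantKernel` — the
  kernel versions of `integral_oddCov_nonneg` / `wilsonExpectation_nonneg_of_oddCovariant`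
  (coordinates `θ t = 1 − t`);
* `wilsonExpectation_nonneg_of_negCovariantKernel` — the kernel version of
  `wilsonExpectation_nonneg_of_negCovariant` (coordinates `t ↦ −t`, `L = 2S + 1`): if
  `Φ (translateLayer S Y U) = Σ_{I,J} g_I(splice_{layer}(U,Y)) conj g_J(negReflect U) P_{IJ}(U)` with
  bounded measurable `g_I` depending on `negSideEdges S ∪ layerEdges S ∪ sliceZeroEdges`, bounded
  measurable `P_{IJ}` depending on `sliceZeroEdges` and `Σ x_I conj x_J P_{IJ}(V) ≥ 0` pointwise, then
  `⟨Φ⟩_{Λ,β} ≥ 0`.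

References: K. Osterwalder, E. Seiler, Ann. Phys. 110 (1978) 440, §2; J. Fröhlich, R. Israel, E. Lieb,
B. Simon, Commun. Math. Phys. 62 (1978) 1, Thm. 2.1; I. Montvay, G. Münster, *Quantum Fields on a
Lattice* (CUP 1994) §4.2.3 (4.107)–(4.110). Everything here is proved; no named fact. [folklore]
-/

open MeasureTheory Finset Complex
open scoped ComplexOrder ENNReal ComplexConjugate

namespace Literature.MathematicalPhysics.QuantumFieldTheory

noncomputable section

namespace WilsonOddRP

open WilsonRP
open Literature.RepresentationTheory.CompactGroups

section Assembly

variable {d L N : ℕ} [NeZero d] [NeZero L] [Fact (1 < L)]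
variable {G : Type*} [Group G] [TopologicalSpace G] [IsTopologicalGroup G] [CompactSpace G]
  [MeasurableSpace G] [BorelSpace G]
variable (ρ : G →* Matrix (Fin N) (Fin N) ℂ)

/-- The doubled integrand of the kernel form. [folklore] -/
def oIntegrandK (hρ : Continuous ρ) (β : ℝ) {𝓘 : Type*} [Fintype 𝓘] (g : 𝓘 → GaugeConfig d L G → ℂ)
    (Pk : 𝓘 → 𝓘 → GaugeConfig d L G → ℂ) (p : GaugeConfig d L G × GaugeConfig d L G) : ℂ :=
  (Real.exp (-β * (N * Fintype.card (Plaquette d L))) : ℂ) *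
    ((∑ I, ∑ J, oObs ρ β (g I) (LatticeRP.splice lowerEdges p) * (starRingEnd ℂ) (oObs ρ β (g J) p.1.timeReflect) *
        Pk I J p.1) *
      Complex.exp (∑ i, oCoeff ρ hρ β i (LatticeRP.splice lowerEdges p) *
        (starRingEnd ℂ) (oCoeff ρ hρ β i p.1.timeReflect)))

omit [MeasurableSpace G] [BorelSpace G] in
/-- **The pointwise identity** after the substitution `translateLow Y`, kernel form: for
`Φ (translateLow Y U) = Σ_{I,J} g_I(z) conj g_J(ΘU) P_{IJ}(U)`,
`e^{-β S(U')} Φ(U') = oIntegrandK (U, Y)`, `U' = translateLow Y U`. [folklore] -/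
theorem oIntegrandK_translateLow (hL : Odd L) (hρ : Continuous ρ) {β : ℝ} (hβ : 0 ≤ β)
    {𝓘 : Type*} [Fintype 𝓘] {g : 𝓘 → GaugeConfig d L G → ℂ} {Pk : 𝓘 → 𝓘 → GaugeConfig d L G → ℂ}
    {Φ : GaugeConfig d L G → ℂ}
    (hcov : ∀ U Y, Φ (translateLow Y U) =
      ∑ I, ∑ J, g I (LatticeRP.splice lowerEdges (U, Y)) * conj (g J U.timeReflect) * Pk I J U)
    (U Y : GaugeConfig d L G) :
    (Real.exp (-β * wilsonAction ρ (translateLow Y U)) : ℂ) * Φ (translateLow Y U) =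
      oIntegrandK ρ hρ β g Pk (U, Y) := by
  have hPM : ∀ e : Edge d L, IsOPosEdge e ∨ IsOSharedEdge e → ¬ IsLowerCross e := fun e he hc => by
    rcases he with he | he
    · exact not_isOPosEdge_of_isLowerCross hc he
    · exact not_isOSharedEdge_of_isLowerCross hc he
  have hA : ∀ V W : GaugeConfig d L G, (∀ e, IsOPosEdge e ∨ IsOSharedEdge e → V e = W e) →
      oPosAction ρ V = oPosAction ρ W := by
    intro V W h
    unfold oPosAction
    refine Finset.sum_congr rfl fun p hp => ?_
    rw [Finset.mem_filter] at hp
    obtain ⟨h1, h2, h3, h4⟩ := edges_of_isOPosPlaq hL hp.2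
    simp only [plaqRe, plaquetteHolonomy, h _ h1, h _ h2, h _ h3, h _ h4]
  have hM : ∀ V W : GaugeConfig d L G, (∀ e, IsOSharedEdge e → V e = W e) →
      oSharedAction ρ V = oSharedAction ρ W := fun V W h =>
    dependsOn_oSharedAction ρ fun e he => h e (by simpa using he)
  have htr : ∀ e, IsOPosEdge e ∨ IsOSharedEdge e → translateLow Y U e = U e := fun e he =>
    translateLow_apply_of_not_isLowerCross Y U (hPM e he)
  have hsp : ∀ e, IsOPosEdge e ∨ IsOSharedEdge e → LatticeRP.splice lowerEdges (U, Y) e = U e :=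
    fun e he => splice_apply_of_not_isLowerCross U Y (hPM e he)
  have hΘtr : ∀ e, IsOPosEdge e ∨ IsOSharedEdge e →
      (translateLow Y U).timeReflect e = U.timeReflect e := by
    intro e he
    have hne : ¬ IsLowerCross (edgeReflect e) := by
      intro hc
      have := edgeReflect_of_isLowerCross (d := d) (L := L) hc
      rw [edgeReflect_edgeReflect] at this
      rw [this] at he
      exact hPM _ he hc
    rw [timeReflect_apply, timeReflect_apply, translateLow_apply_of_not_isLowerCross Y U hne]
  have hA1 : oPosAction ρ (translateLow Y U) = oPosAction ρ U := hA _ _ htr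
  have hA2 : oPosAction ρ (translateLow Y U).timeReflect = oPosAction ρ U.timeReflect := hA _ _ hΘtr
  have hA3 : oPosAction ρ (LatticeRP.splice lowerEdges (U, Y)) = oPosAction ρ U := hA _ _ hsp
  have hM1 : oSharedAction ρ (translateLow Y U) = oSharedAction ρ U :=
    hM _ _ fun e he => htr e (Or.inr he)
  have hM2 : oSharedAction ρ (LatticeRP.splice lowerEdges (U, Y)) = oSharedAction ρ U :=
    hM _ _ fun e he => hsp e (Or.inr he)
  have hM3 : oSharedAction ρ U.timeReflect = oSharedAction ρ U := oSharedAction_timeReflect ρ hL U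
  rw [hcov, wilsonAction_oddSplit ρ hL hρ, hA1, hA2, hM1]
  unfold oIntegrandK oObs
  rw [sum_oCoeff_mul_conj ρ hL hρ hβ, hA3, hM2, hM3, ← Complex.ofReal_exp]
  simp only [map_mul, Complex.conj_ofReal]
  rw [show -β * (↑N * ↑(Fintype.card (Plaquette d L)) -
        (oPosAction ρ U + oPosAction ρ U.timeReflect + oCrossAction ρ (translateLow Y U) +
          oSharedAction ρ U)) =
      -β * (↑N * ↑(Fintype.card (Plaquette d L))) +
        (β * oPosAction ρ U + β / 2 * oSharedAction ρ U) +
        (β * oPosAction ρ U.timeReflect + β / 2 * oSharedAction ρ U) +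
        β * oCrossAction ρ (translateLow Y U) by ring,
    Real.exp_add, Real.exp_add, Real.exp_add]
  push_cast
  simp only [Finset.mul_sum, Finset.sum_mul]
  refine Finset.sum_congr rfl fun I _ => Finset.sum_congr rfl fun J _ => ?_
  ring

omit [Fact (1 < L)] in
/-- The kernel integrand is measurable. [folklore] -/
theorem measurable_oIntegrandK (hρ : Continuous ρ) (β : ℝ) {𝓘 : Type*} [Fintype 𝓘]
    {g : 𝓘 → GaugeConfig d L G → ℂ} {Pk : 𝓘 → 𝓘 → GaugeConfig d L G → ℂ}
    (hg : ∀ I, Measurable (g I)) (hP : ∀ I J, Measurable (Pk I J)) : Measurable (oIntegrandK ρ hρ β g Pk) := by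
  have hg' : ∀ I, Measurable (oObs ρ β (g I)) := fun I => measurable_oObs ρ hρ β (hg I)
  have hconj : Measurable (starRingEnd ℂ : ℂ → ℂ) := Complex.continuous_conj.measurable
  have hsp : Measurable (LatticeRP.splice lowerEdges :
      GaugeConfig d L G × GaugeConfig d L G → GaugeConfig d L G) := LatticeRP.measurable_splice _
  have hΘ1 : Measurable fun p : GaugeConfig d L G × GaugeConfig d L G => p.1.timeReflect :=
    measurable_timeReflect.comp measurable_fst
  refine measurable_const.mul ((Finset.measurable_sum _ fun I _ => Finset.measurable_sum _ fun J _ => ?_).mul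
    (Complex.measurable_exp.comp (Finset.measurable_sum _ fun i _ => ?_)))
  · exact (((hg' I).comp hsp).mul (hconj.comp ((hg' J).comp hΘ1))).mul ((hP I J).comp measurable_fst)
  · exact ((measurable_oCoeff ρ hρ β i).comp hsp).mul (hconj.comp ((measurable_oCoeff ρ hρ β i).comp hΘ1))

omit [Fact (1 < L)] [MeasurableSpace G] [BorelSpace G] in
/-- The kernel integrand is bounded. [folklore] -/
theorem norm_oIntegrandK_le (hρ : Continuous ρ) (β : ℝ) {𝓘 : Type*} [Fintype 𝓘]
    {g : 𝓘 → GaugeConfig d L G → ℂ} {Pk : 𝓘 → 𝓘 → GaugeConfig d L G → ℂ}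
    {Kg : ℝ} (hgb : ∀ I U, ‖g I U‖ ≤ Kg) (hPb : ∀ I J U, ‖Pk I J U‖ ≤ Kg) (p : GaugeConfig d L G × GaugeConfig d L G) :
    ‖oIntegrandK ρ hρ β g Pk p‖ ≤
      Real.exp (-β * (N * Fintype.card (Plaquette d L))) *
        ((Fintype.card 𝓘 * (Fintype.card 𝓘 *
          ((|Kg| * Real.exp ((|β| + |β / 2|) * (N * Fintype.card (Plaquette d L)))) *
            (|Kg| * Real.exp ((|β| + |β / 2|) * (N * Fintype.card (Plaquette d L)))) * |Kg|))) *
          Real.exp (Fintype.card (CoeffIndex d L N) * (Real.sqrt (β / 2) * Real.sqrt (β / 2)))) := by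
  unfold oIntegrandK
  rw [norm_mul, Complex.norm_real, Real.norm_eq_abs, abs_of_pos (Real.exp_pos _)]
  refine mul_le_mul_of_nonneg_left ?_ (Real.exp_pos _).le
  rw [norm_mul]
  refine mul_le_mul ?_ ?_ (norm_nonneg _) (by positivity)
  · refine (norm_sum_le _ _).trans ?_
    calc ∑ I, ‖∑ J, oObs ρ β (g I) (LatticeRP.splice lowerEdges p) * (starRingEnd ℂ) (oObs ρ β (g J) p.1.timeReflect) *
            Pk I J p.1‖
        ≤ ∑ _I : 𝓘, (Fintype.card 𝓘 *
          ((|Kg| * Real.exp ((|β| + |β / 2|) * (N * Fintype.card (Plaquette d L)))) *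
            (|Kg| * Real.exp ((|β| + |β / 2|) * (N * Fintype.card (Plaquette d L)))) * |Kg|)) :=
          Finset.sum_le_sum fun I _ => (norm_sum_le _ _).trans (by
            calc ∑ J, ‖oObs ρ β (g I) (LatticeRP.splice lowerEdges p) * (starRingEnd ℂ) (oObs ρ β (g J) p.1.timeReflect) *
                    Pk I J p.1‖
                ≤ ∑ _J : 𝓘, (|Kg| * Real.exp ((|β| + |β / 2|) * (N * Fintype.card (Plaquette d L)))) *
                    (|Kg| * Real.exp ((|β| + |β / 2|) * (N * Fintype.card (Plaquette d L)))) * |Kg| :=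
                  Finset.sum_le_sum fun J _ => by
                    rw [norm_mul, norm_mul, Complex.norm_conj]
                    exact mul_le_mul (mul_le_mul (norm_oObs_le ρ hρ β (hgb I) _) (norm_oObs_le ρ hρ β (hgb J) _)
                      (norm_nonneg _) (by positivity)) ((hPb I J _).trans (le_abs_self _)) (norm_nonneg _)
                      (by positivity)
              _ = _ := by rw [Finset.sum_const, Finset.card_univ, nsmul_eq_mul])
      _ = _ := by rw [Finset.sum_const, Finset.card_univ, nsmul_eq_mul]
  · rw [Complex.norm_exp]
    refine Real.exp_le_exp.2 ((Complex.re_le_norm _).trans ?_)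
    calc ‖∑ i, oCoeff ρ hρ β i (LatticeRP.splice lowerEdges p) *
            (starRingEnd ℂ) (oCoeff ρ hρ β i p.1.timeReflect)‖
        ≤ ∑ i, ‖oCoeff ρ hρ β i (LatticeRP.splice lowerEdges p) *
            (starRingEnd ℂ) (oCoeff ρ hρ β i p.1.timeReflect)‖ := norm_sum_le _ _
      _ ≤ ∑ _i : CoeffIndex d L N, Real.sqrt (β / 2) * Real.sqrt (β / 2) :=
          Finset.sum_le_sum fun i _ => by
            rw [norm_mul, Complex.norm_conj]
            exact mul_le_mul (norm_oCoeff_le ρ hρ β i _) (norm_oCoeff_le ρ hρ β i _) (norm_nonneg _)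
              (Real.sqrt_nonneg _)
      _ = Fintype.card (CoeffIndex d L N) * (Real.sqrt (β / 2) * Real.sqrt (β / 2)) := by
          rw [Finset.sum_const, Finset.card_univ, nsmul_eq_mul]

/-- **Reflection positivity of the un-normalised Wilson weight on the odd torus, covariant kernel
form**: `0 ≤ ∫ exp(-β S(U)) Φ(U) ∏ dU_e` when `Φ (translateLow Y U) = Σ_{I,J} g_I(z) conj g_J(ΘU) P_{IJ}(U)`
with `P` a bounded measurable kernel depending only on the shared links and positive semidefinite
pointwise. [folklore] -/
theorem integral_oddCovKernel_nonneg (hL : Odd L) (hρ : Continuous ρ) {β : ℝ} (hβ : 0 ≤ β)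
    {𝓘 : Type*} [Fintype 𝓘] {g : 𝓘 → GaugeConfig d L G → ℂ} {Pk : 𝓘 → 𝓘 → GaugeConfig d L G → ℂ}
    (hgm : ∀ I, Measurable (g I)) (hPm : ∀ I J, Measurable (Pk I J))
    {Kg : ℝ} (hgb : ∀ I U, ‖g I U‖ ≤ Kg) (hPb : ∀ I J U, ‖Pk I J U‖ ≤ Kg)
    (hgdep : ∀ I, DependsOn (g I)
      ((oPosEdges ∪ lowerEdges ∪ oSharedEdges : Finset (Edge d L)) : Set (Edge d L)))
    (hPdep : ∀ I J, DependsOn (Pk I J) ((oSharedEdges : Finset (Edge d L)) : Set (Edge d L)))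
    (hPpos : ∀ V (x : 𝓘 → ℂ), 0 ≤ ∑ I, ∑ J, x I * conj (x J) * Pk I J V)
    {Φ : GaugeConfig d L G → ℂ} (hΦm : Measurable Φ)
    (hcov : ∀ U Y, Φ (translateLow Y U) =
      ∑ I, ∑ J, g I (LatticeRP.splice lowerEdges (U, Y)) * conj (g J U.timeReflect) * Pk I J U) :
    0 ≤ ∫ U : GaugeConfig d L G, (Real.exp (-β * wilsonAction ρ U) : ℂ) * Φ U
      ∂(LatticeRP.piMeasure (haarProbability G)) := by
  set μ : Measure (GaugeConfig d L G) := LatticeRP.piMeasure (haarProbability G) with hμ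
  set H : GaugeConfig d L G → ℂ := fun U => (Real.exp (-β * wilsonAction ρ U) : ℂ) * Φ U with hH
  have hHm : Measurable H :=
    (Complex.measurable_ofReal.comp ((WilsonRP.measurable_wilsonAction ρ hρ).const_mul (-β)).exp).mul hΦm
  have hR : ∀ U Y, H (translateLow Y U) = oIntegrandK ρ hρ β g Pk (U, Y) :=
    fun U Y => oIntegrandK_translateLow ρ hL hρ hβ hcov U Y
  have hRi : Integrable (oIntegrandK ρ hρ β g Pk) (μ.prod μ) :=
    Integrable.of_bound (measurable_oIntegrandK ρ hρ β hgm hPm).aestronglyMeasurable _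
      (ae_of_all _ (norm_oIntegrandK_le ρ hρ β hgb hPb))
  have step1 : ∫ U, H U ∂μ = ∫ Y, ∫ U, oIntegrandK ρ hρ β g Pk (U, Y) ∂μ ∂μ := by
    have hY : ∀ Y, ∫ U, H U ∂μ = ∫ U, oIntegrandK ρ hρ β g Pk (U, Y) ∂μ := fun Y => by
      rw [← LatticeRP.integral_comp_eq_of_measurePreserving (measurePreserving_translateLow Y) hHm]
      exact integral_congr_ae (ae_of_all _ fun U => hR U Y)
    calc ∫ U, H U ∂μ = ∫ _Y, (∫ U, H U ∂μ) ∂μ := by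
          rw [integral_const, probReal_univ, one_smul]
      _ = ∫ Y, ∫ U, oIntegrandK ρ hρ β g Pk (U, Y) ∂μ ∂μ := integral_congr_ae (ae_of_all _ hY)
  rw [step1, ← integral_prod_symm _ hRi]
  unfold oIntegrandK
  rw [integral_const_mul]
  refine mul_nonneg (Complex.zero_le_real.2 (Real.exp_pos _).le) ?_
  have hKle : |Kg| ≤ |Kg| * Real.exp ((|β| + |β / 2|) * (N * Fintype.card (Plaquette d L))) :=
    le_mul_of_one_le_right (abs_nonneg _) (Real.one_le_exp (by positivity))
  exact LatticeRP.integral_sum_mul_conj_kernel_mul_exp_nonneg (haarProbability G) oSharedEdges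
    oPosEdges lowerEdges GaugeConfig.timeReflect measurePreserving_timeReflect
    (fun U e he => timeReflect_apply_of_mem_oSharedEdges hL U e he)
    (fun e he => dependsOn_timeReflect_apply hL e he) disjoint_oSharedEdges_oPosEdges
    disjoint_oSharedEdges_lowerEdges (fun I => measurable_oObs ρ hρ β (hgm I)) hPm
    (fun i => measurable_oCoeff ρ hρ β i) (fun I U => norm_oObs_le ρ hρ β (hgb I) U)
    (fun I J U => (hPb I J U).trans ((le_abs_self _).trans hKle))
    (fun i U => norm_oCoeff_le ρ hρ β i U) (fun I => dependsOn_oObs ρ hL β (hgdep I)) hPdep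
    (fun i => dependsOn_oCoeff ρ hL hρ β i) hPpos

end Assembly

end WilsonOddRP

/-! ## The theorems -/

section Main

open WilsonNegRP WilsonOddRP

variable {d L N : ℕ} {G : Type*} [Group G] [TopologicalSpace G] [IsTopologicalGroup G]
  [CompactSpace G] [MeasurableSpace G] [BorelSpace G] (ρ : G →* Matrix (Fin N) (Fin N) ℂ)

/-- **Osterwalder–Seiler reflection positivity on the odd torus, covariant KERNEL form**
(coordinates `θ t = 1 − t`): as `wilsonExpectation_nonneg_of_oddCovariant`, with the observable of the
Hermitian form `Φ (translateLow Y U) = Σ_{I,J} g_I(splice_C(U, Y)) conj g_J(ΘU) P_{IJ}(U)` for a bounded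
measurable kernel `P_{IJ}` depending only on the shared links `M` (`WilsonOddRP.oSharedEdges`) with
`Σ x_I conj x_J P_{IJ}(V) ≥ 0` for all `V, x`. [folklore] -/
theorem wilsonExpectation_nonneg_of_oddCovariantKernel [NeZero d] [NeZero L] (hL : Odd L) (hL3 : 3 ≤ L)
    (hρ : Continuous ρ) {β : ℝ} (hβ : 0 ≤ β)
    {𝓘 : Type*} [Fintype 𝓘] {g : 𝓘 → GaugeConfig d L G → ℂ} {Pk : 𝓘 → 𝓘 → GaugeConfig d L G → ℂ}
    (hgm : ∀ I, Measurable (g I)) (hPm : ∀ I J, Measurable (Pk I J))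
    {Kg : ℝ} (hgb : ∀ I U, ‖g I U‖ ≤ Kg) (hPb : ∀ I J U, ‖Pk I J U‖ ≤ Kg)
    (hgdep : ∀ I, DependsOn (g I)
      ((WilsonOddRP.oPosEdges ∪ WilsonOddRP.lowerEdges ∪ WilsonOddRP.oSharedEdges :
        Finset (Edge d L)) : Set (Edge d L)))
    (hPdep : ∀ I J, DependsOn (Pk I J) ((WilsonOddRP.oSharedEdges : Finset (Edge d L)) : Set (Edge d L)))
    (hPpos : ∀ V (x : 𝓘 → ℂ), 0 ≤ ∑ I, ∑ J, x I * conj (x J) * Pk I J V)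
    {Φ : GaugeConfig d L G → ℂ} (hΦm : Measurable Φ)
    (hcov : ∀ U Y, Φ (WilsonOddRP.translateLow Y U) =
      ∑ I, ∑ J, g I (LatticeRP.splice WilsonOddRP.lowerEdges (U, Y)) * conj (g J U.timeReflect) * Pk I J U) :
    0 ≤ wilsonExpectation ρ β Φ := by
  haveI : Fact (1 < L) := ⟨by omega⟩
  have hdens : Measurable fun U : GaugeConfig d L G =>
      ENNReal.ofReal (Real.exp (-β * wilsonAction ρ U)) :=
    ENNReal.measurable_ofReal.comp ((WilsonRP.measurable_wilsonAction ρ hρ).const_mul (-β)).exp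
  unfold wilsonExpectation wilsonMeasure
  rw [integral_smul_measure]
  unfold wilsonWeight
  rw [integral_withDensity_eq_integral_toReal_smul hdens (ae_of_all _ fun _ => ENNReal.ofReal_lt_top)]
  simp_rw [ENNReal.toReal_ofReal (Real.exp_nonneg _), Complex.real_smul]
  refine mul_nonneg (Complex.zero_le_real.2 ENNReal.toReal_nonneg) ?_
  exact WilsonOddRP.integral_oddCovKernel_nonneg ρ hL hρ hβ hgm hPm hgb hPb hgdep hPdep hPpos hΦm hcov

omit [Group G] [TopologicalSpace G] [IsTopologicalGroup G] [CompactSpace G] [BorelSpace G] in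
/-- A function of the slice-`0` links, read through the translation, is a function of Wave 0's shared
links. [folklore] -/
theorem dependsOn_comp_torusConfigShift_slice [NeZero d] [NeZero L] {S : ℕ} (hL : L = 2 * S + 1)
    (hS : 1 ≤ S) {P : GaugeConfig d L G → ℂ}
    (hP : DependsOn P (↑(sliceZeroEdges : Finset (Edge d L)) : Set (Edge d L))) :
    DependsOn (P ∘ torusConfigShift (shiftVec S))
      (↑(WilsonOddRP.oSharedEdges : Finset (Edge d L)) : Set (Edge d L)) := by
  intro U' V' hUV
  simp only [Function.comp_apply]
  refine hP fun e he => ?_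
  rw [torusConfigShift_apply, torusConfigShift_apply]
  refine hUV _ (mem_coe.2 ?_)
  simp only [sliceZeroEdges, mem_coe, mem_filter, mem_univ, true_and] at he
  rw [WilsonOddRP.mem_oSharedEdges, WilsonOddRP.IsOSharedEdge]
  change e.2 ≠ 0 ∧ ((e.1 - shiftVec (d := d) (L := L) S : Site d L) 0).val = L / 2 + 1
  rw [sub_shiftVec_apply_zero]
  exact ⟨he.1, val_sub_of_zero hL hS he.2⟩

/-- **Osterwalder–Seiler reflection positivity on the odd torus, covariant KERNEL form, in the
site-reflection coordinates `t ↦ −t`** (`L = 2S+1`, `S ≥ 1`, continuous `ρ`, `β ≥ 0`; reflection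
`GaugeConfig.negReflect` fixing the slice `t = 0` and the temporal layer `S → S+1`): if a measurable
observable `Φ` satisfies, for all `U, Y`,
`Φ (translateLayer S Y U) = Σ_{I,J} g_I(splice_{layerEdges S}(U, Y)) · conj g_J(negReflect U) · P_{IJ}(U)`
for finitely many bounded measurable `g_I` depending only on the links of
`negSideEdges S ∪ layerEdges S ∪ sliceZeroEdges` and a bounded measurable kernel `P_{IJ}` depending
only on `sliceZeroEdges` with `Σ x_I conj x_J P_{IJ}(V) ≥ 0` pointwise, then `⟨Φ⟩_{Λ,β} ≥ 0`
(the form produced by integrating out fermions living in the reflection slice: Montvay–Münster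
(4.107)–(4.110)). [cite: OsterwalderSeiler1978, §2] [cite: MontvayMunster1994, §4.2.3 (4.107)–(4.110)] -/
theorem wilsonExpectation_nonneg_of_negCovariantKernel [NeZero d] [NeZero L] {S : ℕ} (hL : L = 2 * S + 1)
    (hS : 1 ≤ S) (hρ : Continuous ρ) {β : ℝ} (hβ : 0 ≤ β)
    {𝓘 : Type*} [Fintype 𝓘] {g : 𝓘 → GaugeConfig d L G → ℂ} {Pk : 𝓘 → 𝓘 → GaugeConfig d L G → ℂ}
    (hgm : ∀ I, Measurable (g I)) (hPm : ∀ I J, Measurable (Pk I J))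
    {Kg : ℝ} (hgb : ∀ I U, ‖g I U‖ ≤ Kg) (hPb : ∀ I J U, ‖Pk I J U‖ ≤ Kg)
    (hgdep : ∀ I, DependsOn (g I)
      (↑(negSideEdges S ∪ layerEdges S ∪ sliceZeroEdges : Finset (Edge d L)) : Set (Edge d L)))
    (hPdep : ∀ I J, DependsOn (Pk I J) (↑(sliceZeroEdges : Finset (Edge d L)) : Set (Edge d L)))
    (hPpos : ∀ V (x : 𝓘 → ℂ), 0 ≤ ∑ I, ∑ J, x I * conj (x J) * Pk I J V)
    {Φ : GaugeConfig d L G → ℂ} (hΦm : Measurable Φ)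
    (hcov : ∀ U Y, Φ (translateLayer S Y U) =
      ∑ I, ∑ J, g I (LatticeRP.splice (layerEdges S) (U, Y)) * conj (g J U.negReflect) * Pk I J U) :
    0 ≤ wilsonExpectation ρ β Φ := by
  have hodd : Odd L := ⟨S, hL⟩
  have hL3 : 3 ≤ L := by omega
  set τ := torusConfigShift (G := G) (shiftVec (d := d) (L := L) S) with hτ
  have hτm : Measurable τ := (torusConfigShift (G := G) (shiftVec (d := d) (L := L) S)).measurable
  rw [← wilsonExpectation_comp_torusConfigShift ρ β (shiftVec S) Φ]
  refine wilsonExpectation_nonneg_of_oddCovariantKernel ρ hodd hL3 hρ hβ (𝓘 := 𝓘) (g := fun I => g I ∘ τ)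
    (Pk := fun I J => Pk I J ∘ τ) (fun I => (hgm I).comp hτm) (fun I J => (hPm I J).comp hτm) (Kg := Kg)
    (fun I U => hgb I _) (fun I J U => hPb I J _)
    (fun I => dependsOn_comp_torusConfigShift hL hS (hgdep I))
    (fun I J => dependsOn_comp_torusConfigShift_slice hL hS (hPdep I J)) (fun V x => hPpos _ x)
    (hΦm.comp hτm) fun U' Y' => ?_
  simp only [Function.comp_apply, hτ]
  rw [torusConfigShift_translateLow hL, hcov, splice_layerEdges_torusConfigShift hL,
    negReflect_torusConfigShift hL]

end Main

end

end Literature.MathematicalPhysics.QuantumFieldTheory
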